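/-
Copyright: the b2b-balaban cell (near-miss cell 7), T⁴-continuum fan-out; row NE7b ROUND-2 swarm, seat
t4-ne7b-formalise-leaf-10 (gen 6) — supplier piece «T3b-SORT-TRANSPORT», v2 letters (T3b holder leaf-05 g4's AMENDMENT,
journal l.14398 (1): the cluster predicate ALSO carries the non-emptiness of the listed zones).  A supplier module
consumed BY NAME; not a claim of T3b.  Released under the licence of the surrounding project.
-/
import Summits.QuantumFields.BalabanUV.T4Continuum.Support.HistoryMemberClusterConn

/-!
# Cluster properties of a member, generically; `ClusterConnNE` (touch-connected AND non-empty part zones) and its transport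

Summits-side support leaf of the T⁴-continuum cell (rung (B)+1 on a FINITE torus only; NOT infinite volume, NOT the
mass gap, NOT the Clay statement; NOT a proof of the spine estimate NE7b).  Row NE7b, route «COUNT», row S6g′
INSTANCE, piece T3b-3 (holder leaf-05 g4), sequel of `HistoryMemberClusterConn` (`PGen.ClusterConn`,
`clusterConn_toPGen_sortR`).  The T3b holder's consumer pulls the zone-list touch-connectedness back to the part list
with leaf-02 g6's `HistoryJoinsClusterContact.tconn_of_tconn_map`, whose reflexivity input is «each listed zone touches
itself» = is NON-EMPTY; so the transported datum must be the CONJUNCTION (amended letters, l.14398 (1)) — which is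
again a members-based property of the same zone list.  This file proves the structural calculus and the transport ONCE
for an ARBITRARY property `Φ` of the part-zone list (`PGen.ClusterProp Φ Zm`), permutation-invariant where the
transport needs it, and instantiates: `ClusterConn = ClusterProp (TConn touch)` (`Iff.rfl`) and **`ClusterConnNE`**
(the amended letters, token for token) `↔ ClusterProp (fun l => (∀ A ∈ l, A.Nonempty) ∧ TConn touch l)`.  [folklore]
structural recursion, list permutations; nothing is quoted from print, nothing printed is asserted, no `[cite:]` tag;
two predicates WITH parameters (`ClusterProp`, `ClusterConnNE`), no `Prop`-valued fact (trigger c1).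

WHAT.
* §1 (ns `…HistoryAdmissible.PGen`; `Φ : List (Finset β) → Prop`, `Zm : ℕ → PGen γ → Finset β`) **`ClusterProp Φ Zm g :=
  ∀ q ∈ croots PEv.step g.toGen, Φ ((jparts PEv.step q.2).map fun p => Zm (ftime PEv.step q.2) (subAt g (q.1 ++ p.1)))`**,
  `clusterConn_iff_clusterProp`, `clusterProp_birth`, **`clusterProp_renew_iff`**, **`clusterProp_join_iff`**,
  `clusterProp_subAt_of_mem_jparts`, **`clusterProp_chainJoin_iff`**, `clusterProp_mono`, `clusterProp_and_iff`.
* §2 (ns `…HistoryGen.Pedigree`) `clusterProp_partPGen_sortR`, **`clusterProp_toPGen_sortR (hΦ : ∀ l l', l.Perm l' →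
  Φ l → Φ l') (hH) (hS) (hZ) (c) : ClusterProp Φ Zm (P.toPGen cell c) → ClusterProp Φ Zm (P.sortR.toPGen cell c)`**.
* §3 (ns `…HistoryAdmissible.PGen`) **`ClusterConnNE Zm g : Prop := ∀ q ∈ croots PEv.step g.toGen, (∀ p ∈ jparts PEv.step
  q.2, (Zm (ftime PEv.step q.2) (subAt g (q.1 ++ p.1))).Nonempty) ∧ TConn (fun A B => (A ∩ B).Nonempty) ((jparts PEv.step
  q.2).map fun p => Zm (ftime PEv.step q.2) (subAt g (q.1 ++ p.1)))`** (leaf-05 g4's AMENDED letters = the conclusion of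
  its `clusterConn_of_realises`, token for token), **`clusterConnNE_iff_clusterProp`**, `ClusterConnNE.clusterConn`,
  `ClusterConnNE.nonempty`, `clusterConnNE_birth`, **`clusterConnNE_renew_iff`**, **`clusterConnNE_join_iff`**,
  `clusterConnNE_subAt_of_mem_jparts`, **`clusterConnNE_chainJoin_iff`**, `perm_nonemptyTConn`; §4 (ns
  `…HistoryGen.Pedigree`) **`clusterConnNE_toPGen_sortR (hH) (hS) (hZ) (c) : ClusterConnNE Zm (P.toPGen cell c) →
  ClusterConnNE Zm (P.sortR.toPGen cell c)`**.  §5 sanity.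

HONEST SCOPE.  The member side only, as `HistoryMemberClusterConn`.  Nothing of H3∕(B)∕BetaPertH touched; `hdis`∕`hmult`∕
`resum`∕`BirthShapeNodup` NOT retired; NE7b NOT proved; spine 0∕9.  HONEST DEPENDENCY (cell): continuum YM on T⁴ ⇐
BetaPertH ∧ nine spine estimates (0/9 proved); BetaPertH ⇐ (D1) ∧ (D4) ∧ CAP+tail; G-an2-4 gates asym, D1 and NE2/3/4.
This file changes none of it.
-/

open Literature.MathematicalPhysics.QuantumFieldTheory.Balaban1983to89
open T4PersistenceDictionary
open Summit.QuantumFields.BalabanUV.T4Continuum.HistoryGen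
open Summit.QuantumFields.BalabanUV.T4Continuum.HistoryJoins
open Summit.QuantumFields.BalabanUV.T4Continuum.HistoryJoinsAdm
open Summit.QuantumFields.BalabanUV.T4Continuum.HistoryZoneMassPieces (TConn tconn_singleton)
open Summit.QuantumFields.BalabanUV.T4Continuum.ZoneTorus (ftime)
open Summit.QuantumFields.BalabanUV.T4Continuum.HistoryMemberClusterConn

noncomputable section

/-! ## §1 A property of the part-zone list at every join root -/

namespace Summit.QuantumFields.BalabanUV.T4Continuum.HistoryAdmissible.PGen

variable {γ β : Type*} (Φ : List (Finset β) → Prop) (Zm : ℕ → PGen γ → Finset β)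

/-- **A PROPERTY OF THE PART-ZONE LIST AT EVERY JOIN ROOT** of the member's flat tree (the zones AT THE JOIN STEP of
the top cluster's part SUB-MEMBERS); `ClusterConn` is the case `Φ := TConn touch` (`clusterConn_iff_clusterProp`).
[folklore] -/
def ClusterProp (g : PGen γ) : Prop :=
  ∀ q ∈ croots PEv.step g.toGen, Φ ((jparts PEv.step q.2).map fun p => Zm (ftime PEv.step q.2) (subAt g (q.1 ++ p.1)))

/-- `ClusterConn` is the cluster property of touch-connectedness [folklore] -/
theorem clusterConn_iff_clusterProp [DecidableEq β] (g : PGen γ) :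
    ClusterConn Zm g ↔ ClusterProp (TConn fun A B : Finset β => (A ∩ B).Nonempty) Zm g := Iff.rfl

/-- a bare birth has no join [folklore] -/
theorem clusterProp_birth (j d : ℕ) (z : γ) : ClusterProp Φ Zm (birth j d z) := by
  intro q hq; simp [toGen, croots, crootsP] at hq

/-- **A RENEWAL HAS THE CLUSTER PROPERTY IFF THE RENEWED MEMBER HAS.** [folklore] -/
theorem clusterProp_renew_iff (G : PGen γ) (h : ℕ) : ClusterProp Φ Zm (renew G h) ↔ ClusterProp Φ Zm G := by
  have hc : croots PEv.step (renew G h).toGen = croots PEv.step G.toGen := rfl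
  unfold ClusterProp
  rw [hc]
  refine forall₂_congr fun q hq => ?_
  rw [List.map_congr_left fun p hp => by
    rw [subAt_renew_of_ne_nil G h (by
      intro h0
      have := fst_ne_nil_of_mem_jparts_croots PEv.step hq hp
      rw [List.append_eq_nil_iff] at h0
      exact this h0.2)]]

/-- **A JOIN HAS THE CLUSTER PROPERTY IFF ITS TOP CLUSTER'S PART-ZONE LIST AT THE JOIN STEP HAS `Φ` AND EVERY PART
SUB-MEMBER HAS THE CLUSTER PROPERTY.** [folklore] -/
theorem clusterProp_join_iff (X Y : PGen γ) (s : ℕ) :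
    ClusterProp Φ Zm (join X Y s) ↔
      Φ ((jparts PEv.step (join X Y s).toGen).map fun p => Zm s (subAt (join X Y s) p.1)) ∧
        ∀ p ∈ jparts PEv.step (join X Y s).toGen, ClusterProp Φ Zm (subAt (join X Y s) p.1) := by
  have hm := mem_croots_merge_iff PEv.step X.toGen Y.toGen ((s, 2, 0) : PEv)
  have hG : (join X Y s).toGen = Gen.merge X.toGen Y.toGen ((s, 2, 0) : PEv) := rfl
  have hft : ftime PEv.step (Gen.merge X.toGen Y.toGen ((s, 2, 0) : PEv)) = s := rfl
  -- the shifted lists are the part sub-members' own lists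
  have hshift : ∀ p ∈ jparts PEv.step (join X Y s).toGen, ∀ q' ∈ croots PEv.step p.2,
      ((jparts PEv.step q'.2).map fun p' => Zm (ftime PEv.step q'.2) (subAt (join X Y s) ((p.1 ++ q'.1) ++ p'.1))) =
        (jparts PEv.step q'.2).map fun p' =>
          Zm (ftime PEv.step q'.2) (subAt (subAt (join X Y s) p.1) (q'.1 ++ p'.1)) := by
    intro p hp q' _
    refine List.map_congr_left fun p' _ => ?_
    rw [List.append_assoc, subAt_append _ (subAt_of_mem_jparts hp).1]
  constructor
  · intro H
    refine ⟨?_, fun p hp q' hq' => ?_⟩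
    · have := H ([], (join X Y s).toGen) (by rw [hG]; exact (hm _).2 (Or.inl rfl))
      simpa [hG, hft] using this
    · have hq'' : q' ∈ croots PEv.step p.2 := by rwa [← (subAt_of_mem_jparts hp).2]
      have hmem : (p.1 ++ q'.1, q'.2) ∈ croots PEv.step (join X Y s).toGen := by
        rw [hG]; exact (hm _).2 (Or.inr ⟨p, hp, q', hq'', rfl⟩)
      have := H _ hmem
      rw [hshift p hp q' hq''] at this
      exact this
  · rintro ⟨Htop, Hparts⟩ q hq
    rw [hG] at hq
    rcases (hm q).1 hq with rfl | ⟨p, hp, q', hq', rfl⟩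
    · simpa [hG, hft] using Htop
    · rw [hshift p hp q' hq']
      have hq'' : q' ∈ croots PEv.step (subAt (join X Y s) p.1).toGen := by rwa [(subAt_of_mem_jparts hp).2]
      exact Hparts p hp q' hq''

/-- **THE CLUSTER PROPERTY DESCENDS TO THE PART SUB-MEMBERS** of the top join. [folklore] -/
theorem clusterProp_subAt_of_mem_jparts {g : PGen γ} (H : ClusterProp Φ Zm g) {p : List Bool × Gen PEv}
    (hp : p ∈ jparts PEv.step g.toGen) : ClusterProp Φ Zm (subAt g p.1) := by
  cases g with
  | birth j d z => simp [toGen, jparts] at hp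
  | renew G h => simp [toGen, jparts] at hp
  | join X Y s => exact ((clusterProp_join_iff Φ Zm X Y s).1 H).2 p hp

/-- **A CHAIN OF CLOSED MEMBERS HAS THE CLUSTER PROPERTY IFF THE MEMBERS' ZONE LIST AT THE CHAIN'S STEP HAS `Φ` AND
EVERY MEMBER HAS THE CLUSTER PROPERTY.** [folklore] -/
theorem clusterProp_chainJoin_iff (s : ℕ) (A : PGen γ) (Bs : List (PGen γ)) (hBs : Bs ≠ [])
    (hT : ∀ M ∈ A :: Bs, ∀ X Y, M ≠ join X Y s) :
    ClusterProp Φ Zm (chainJoin A Bs s) ↔ Φ ((A :: Bs).map (Zm s)) ∧ ∀ M ∈ A :: Bs, ClusterProp Φ Zm M := by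
  obtain ⟨C, B, e⟩ := exists_chainJoin_eq_join s A Bs hBs
  have key := clusterProp_join_iff Φ Zm C B s
  rw [← e] at key
  rw [key]
  have hm := map_subAt_jparts_chainJoin s A Bs hBs hT
  have h1 : ((jparts PEv.step (chainJoin A Bs s).toGen).map fun p => Zm s (subAt (chainJoin A Bs s) p.1)) =
      (A :: Bs).map (Zm s) := by
    rw [← hm, List.map_map]; rfl
  rw [h1, ← hm, List.forall_mem_map]


/-- monotonicity in the property [folklore] -/
theorem clusterProp_mono {Φ Φ' : List (Finset β) → Prop} (h : ∀ l, Φ l → Φ' l) {g : PGen γ} (H : ClusterProp Φ Zm g) :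
    ClusterProp Φ' Zm g := fun q hq => h _ (H q hq)

/-- the cluster property of a conjunction is the conjunction of the cluster properties [folklore] -/
theorem clusterProp_and_iff {Φ Φ' : List (Finset β) → Prop} (g : PGen γ) :
    ClusterProp (fun l => Φ l ∧ Φ' l) Zm g ↔ ClusterProp Φ Zm g ∧ ClusterProp Φ' Zm g :=
  ⟨fun H => ⟨fun q hq => (H q hq).1, fun q hq => (H q hq).2⟩, fun H q hq => ⟨H.1 q hq, H.2 q hq⟩⟩

end Summit.QuantumFields.BalabanUV.T4Continuum.HistoryAdmissible.PGen

/-! ## §2 The generic transport to the sorted twin -/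

namespace Summit.QuantumFields.BalabanUV.T4Continuum.HistoryGen.Pedigree

open Summit.QuantumFields.BalabanUV.T4Continuum.HistoryAdmissible

variable {α π γ β : Type*} [Inhabited γ] (P : Pedigree α π) (cell : π → γ)
  (Φ : List (Finset β) → Prop) (Zm : ℕ → PGen γ → Finset β)

/-- **TRANSPORT ON ONE PART**, given the transport on all EARLIER components: a new region is the same birth on both
sides, an old part is the earlier component's member (hypothesis), a renewed old part goes through
`clusterConn_renew_iff`. [folklore] -/
theorem clusterProp_partPGen_sortR (c : α)
    (ih : ∀ c', P.step c' < P.step c →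
      PGen.ClusterProp Φ Zm (P.toPGen cell c') → PGen.ClusterProp Φ Zm (P.sortR.toPGen cell c'))
    {q : Part α π} (hq : q ∈ P.parts c) :
    PGen.ClusterProp Φ Zm (P.partPGen cell c (P.toPGen cell) q) →
      PGen.ClusterProp Φ Zm (P.sortR.partPGen cell c (P.sortR.toPGen cell) q) := by
  rcases q with ⟨c', _ | _⟩ | ⟨d, x⟩
  · exact ih c' (P.step_lt c c' false hq)
  · intro h
    have h' := (PGen.clusterProp_renew_iff Φ Zm _ _).1 h
    exact (PGen.clusterProp_renew_iff Φ Zm _ _).2 (ih c' (P.step_lt c c' true hq) h')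
  · exact id

/-- **THE TRANSPORT OF A PERMUTATION-INVARIANT CLUSTER PROPERTY TO THE SORTED TWIN**: under «oldest line first» and
renewal dating (the fields `headOldest`∕`renew_step` of H3's `RealisedDomainsR`) and a member-zone reading the physical
births only. [folklore] -/
theorem clusterProp_toPGen_sortR (hΦ : ∀ l l' : List (Finset β), l.Perm l' → Φ l → Φ l')
    (hH : ∀ c, P.HeadOldest c) (hS : P.RenewDated)
    (hZ : ∀ t m m', m.pbirths = m'.pbirths → Zm t m = Zm t m') (c : α) :
    PGen.ClusterProp Φ Zm (P.toPGen cell c) → PGen.ClusterProp Φ Zm (P.sortR.toPGen cell c) := by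
  intro H
  -- transport on the parts (earlier components by induction)
  have hpart : ∀ q ∈ P.parts c, PGen.ClusterProp Φ Zm (P.partPGen cell c (P.toPGen cell) q) →
      PGen.ClusterProp Φ Zm (P.sortR.partPGen cell c (P.sortR.toPGen cell) q) := by
    intro q hq
    refine P.clusterProp_partPGen_sortR cell Φ Zm c (fun c' hlt => ?_) hq
    exact clusterProp_toPGen_sortR hΦ hH hS hZ c'
  -- the parts' zones agree (zones read the births only)
  have hzone : ∀ q ∈ P.parts c, ∀ t,
      Zm t (P.sortR.partPGen cell c (P.sortR.toPGen cell) q) = Zm t (P.partPGen cell c (P.toPGen cell) q) :=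
    fun q _ t => hZ t _ _ (P.partPGen_sortR_agree cell hH hS c q).2.2.2
  cases hps : P.parts c with
  | nil =>
      rw [toPGen_of_nil cell P.sortR (P.parts_sortR_of_nil hps)]
      exact PGen.clusterProp_birth Φ Zm _ _ _
  | cons p ps =>
      have hp : p ∈ P.parts c := by rw [hps]; exact List.mem_cons_self
      have hps_sub : ∀ q ∈ ps, q ∈ P.parts c := fun q hq => by rw [hps]; exact List.mem_cons_of_mem _ hq
      cases ps with
      | nil =>
          -- one part: both members ARE the part's `PGen`
          have hR : P.toPGen cell c = P.partPGen cell c (P.toPGen cell) p := by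
            rw [toPGen_of_cons cell P hps]; rfl
          have hS' : P.sortR.toPGen cell c = P.sortR.partPGen cell c (P.sortR.toPGen cell) p := by
            rw [P.toPGen_sortR_of_cons cell hps, List.mergeSort_nil]; rfl
          rw [hS']
          exact hpart p hp (hR ▸ H)
      | cons p' ps' =>
          -- at least two parts: both members are chains over closed members, same head, tail a permutation
          set f := P.partPGen cell c (P.toPGen cell) with hf
          set f' := P.sortR.partPGen cell c (P.sortR.toPGen cell) with hf'
          set qs := (p' :: ps').mergeSort fun q q' => decide (P.keyR c q ≤ P.keyR c q') with hqs
          have hperm : qs.Perm (p' :: ps') := P.sortTail_perm (p' :: ps')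
          have hqs_ne : qs ≠ [] := fun h0 => by
            have := hperm.length_eq; rw [h0] at this; simp at this
          have hR : P.toPGen cell c = chainJoin (f p) ((p' :: ps').map f) (P.step c) := toPGen_of_cons cell P hps
          have hSo : P.sortR.toPGen cell c = chainJoin (f' p) (qs.map f') (P.step c) :=
            P.toPGen_sortR_of_cons cell hps
          -- members closed at the step
          have hT : ∀ M ∈ f p :: (p' :: ps').map f, ∀ X Y, M ≠ PGen.join X Y (P.step c) := by
            intro M hM X Y
            obtain ⟨q, hq, rfl⟩ : ∃ q ∈ P.parts c, f q = M := by
              rcases List.mem_cons.1 hM with rfl | hM'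
              · exact ⟨p, hp, rfl⟩
              · obtain ⟨q, hq, rfl⟩ := List.mem_map.1 hM'
                exact ⟨q, hps_sub q hq, rfl⟩
            exact P.partPGen_ne_join_step cell hS c hq X Y
          have hT' : ∀ M ∈ f' p :: qs.map f', ∀ X Y, M ≠ PGen.join X Y (P.step c) := by
            intro M hM X Y
            obtain ⟨q, hq, rfl⟩ : ∃ q ∈ P.parts c, f' q = M := by
              rcases List.mem_cons.1 hM with rfl | hM'
              · exact ⟨p, hp, rfl⟩
              · obtain ⟨q, hq, rfl⟩ := List.mem_map.1 hM'
                exact ⟨q, hps_sub q (hperm.mem_iff.1 hq), rfl⟩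
            have := P.sortR.partPGen_ne_join_step cell (HistorySiblingEntropyBridge.renewDated_sortR P hS) c
              (P.mem_parts_sortR.2 hq) X Y
            simpa only [step_sortR] using this
          rw [hR] at H
          rw [hSo]
          obtain ⟨Htop, Hmem⟩ :=
            (PGen.clusterProp_chainJoin_iff Φ Zm (P.step c) (f p) ((p' :: ps').map f) (by simp) hT).1 H
          refine (PGen.clusterProp_chainJoin_iff Φ Zm (P.step c) (f' p) (qs.map f') (by simpa using hqs_ne) hT').2
            ⟨?_, ?_⟩
          · -- the top zone list of the twin is a permutation of the realised one
            have e1 : (f' p :: qs.map f').map (Zm (P.step c)) = (p :: qs).map (Zm (P.step c) ∘ f) := by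
              rw [← List.map_cons, List.map_map]
              exact List.map_congr_left fun q hq => by
                have hq' : q ∈ P.parts c := by
                  rcases List.mem_cons.1 hq with rfl | hq
                  · exact hp
                  · exact hps_sub q (hperm.mem_iff.1 hq)
                exact hzone q hq' _
            have e2 : (f p :: (p' :: ps').map f).map (Zm (P.step c)) =
                (p :: p' :: ps').map (Zm (P.step c) ∘ f) := by
              rw [← List.map_cons, List.map_map]
            rw [e1]
            rw [e2] at Htop
            exact hΦ _ _ ((hperm.cons p).map _).symm Htop
          · intro M hM
            rcases List.mem_cons.1 hM with rfl | hM'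
            · exact hpart p hp (Hmem _ List.mem_cons_self)
            · obtain ⟨q, hq, rfl⟩ := List.mem_map.1 hM'
              have hq' : q ∈ p' :: ps' := hperm.mem_iff.1 hq
              exact hpart q (hps_sub q hq') (Hmem _ (List.mem_cons_of_mem _ (List.mem_map.2 ⟨q, hq', rfl⟩)))
termination_by P.step c
decreasing_by exact hlt

end Summit.QuantumFields.BalabanUV.T4Continuum.HistoryGen.Pedigree

/-! ## §3 `ClusterConnNE`: touch-connected AND non-empty part zones (the amended letters) -/

namespace Summit.QuantumFields.BalabanUV.T4Continuum.HistoryAdmissible.PGen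

variable {γ β : Type*} [DecidableEq β] (Zm : ℕ → PGen γ → Finset β)

/-- **THE AMENDED CLUSTER-CONTACT PREDICATE** (leaf-05 g4, journal l.14398 (1) — the conclusion of its
`clusterConn_of_realises`, token for token): at every join root, every listed part zone at the join step is NON-EMPTY
and the list is touch-connected. [folklore] -/
def ClusterConnNE (g : PGen γ) : Prop :=
  ∀ q ∈ croots PEv.step g.toGen,
    (∀ p ∈ jparts PEv.step q.2, (Zm (ftime PEv.step q.2) (subAt g (q.1 ++ p.1))).Nonempty) ∧
      TConn (fun A B : Finset β => (A ∩ B).Nonempty)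
        ((jparts PEv.step q.2).map fun p => Zm (ftime PEv.step q.2) (subAt g (q.1 ++ p.1)))

/-- the members-based property «all non-empty ∧ touch-connected» [folklore] -/
def NonemptyTConn (l : List (Finset β)) : Prop :=
  (∀ A ∈ l, A.Nonempty) ∧ TConn (fun A B : Finset β => (A ∩ B).Nonempty) l

/-- it is permutation-invariant [folklore] -/
theorem perm_nonemptyTConn {l l' : List (Finset β)} (h : l.Perm l') (hl : NonemptyTConn l) : NonemptyTConn l' :=
  ⟨fun A hA => hl.1 A (h.mem_iff.2 hA), tconn_of_perm h hl.2⟩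

/-- **`ClusterConnNE` IS THE CLUSTER PROPERTY OF `NonemptyTConn`.** [folklore] -/
theorem clusterConnNE_iff_clusterProp (g : PGen γ) : ClusterConnNE Zm g ↔ ClusterProp NonemptyTConn Zm g := by
  refine forall₂_congr fun q _ => and_congr ?_ Iff.rfl
  rw [List.forall_mem_map]

/-- the touch-connected half [folklore] -/
theorem ClusterConnNE.clusterConn {g : PGen γ} (H : ClusterConnNE Zm g) : ClusterConn Zm g := fun q hq => (H q hq).2

/-- the non-emptiness half [folklore] -/
theorem ClusterConnNE.nonempty {g : PGen γ} (H : ClusterConnNE Zm g) :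
    ∀ q ∈ croots PEv.step g.toGen, ∀ p ∈ jparts PEv.step q.2,
      (Zm (ftime PEv.step q.2) (subAt g (q.1 ++ p.1))).Nonempty := fun q hq => (H q hq).1

/-- a bare birth [folklore] -/
theorem clusterConnNE_birth (j d : ℕ) (z : γ) : ClusterConnNE Zm (birth j d z) :=
  (clusterConnNE_iff_clusterProp Zm _).2 (clusterProp_birth _ Zm j d z)

/-- **renewals are transparent** [folklore] -/
theorem clusterConnNE_renew_iff (G : PGen γ) (h : ℕ) : ClusterConnNE Zm (renew G h) ↔ ClusterConnNE Zm G := by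
  rw [clusterConnNE_iff_clusterProp, clusterConnNE_iff_clusterProp, clusterProp_renew_iff]

/-- **a join**: the top part-zone list is non-empty-and-touch-connected and every part sub-member is `ClusterConnNE`
[folklore] -/
theorem clusterConnNE_join_iff (X Y : PGen γ) (s : ℕ) :
    ClusterConnNE Zm (join X Y s) ↔
      NonemptyTConn ((jparts PEv.step (join X Y s).toGen).map fun p => Zm s (subAt (join X Y s) p.1)) ∧
        ∀ p ∈ jparts PEv.step (join X Y s).toGen, ClusterConnNE Zm (subAt (join X Y s) p.1) := by
  rw [clusterConnNE_iff_clusterProp, clusterProp_join_iff]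
  refine and_congr Iff.rfl (forall₂_congr fun p _ => ?_)
  rw [clusterConnNE_iff_clusterProp]

/-- descent to the part sub-members [folklore] -/
theorem clusterConnNE_subAt_of_mem_jparts {g : PGen γ} (H : ClusterConnNE Zm g) {p : List Bool × Gen PEv}
    (hp : p ∈ jparts PEv.step g.toGen) : ClusterConnNE Zm (subAt g p.1) :=
  (clusterConnNE_iff_clusterProp Zm _).2
    (clusterProp_subAt_of_mem_jparts _ Zm ((clusterConnNE_iff_clusterProp Zm _).1 H) hp)

/-- **a chain of closed members** [folklore] -/
theorem clusterConnNE_chainJoin_iff (s : ℕ) (A : PGen γ) (Bs : List (PGen γ)) (hBs : Bs ≠ [])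
    (hT : ∀ M ∈ A :: Bs, ∀ X Y, M ≠ join X Y s) :
    ClusterConnNE Zm (chainJoin A Bs s) ↔
      NonemptyTConn ((A :: Bs).map (Zm s)) ∧ ∀ M ∈ A :: Bs, ClusterConnNE Zm M := by
  rw [clusterConnNE_iff_clusterProp, clusterProp_chainJoin_iff _ Zm s A Bs hBs hT]
  refine and_congr Iff.rfl (forall₂_congr fun M _ => ?_)
  rw [clusterConnNE_iff_clusterProp]

end Summit.QuantumFields.BalabanUV.T4Continuum.HistoryAdmissible.PGen

/-! ## §4 The transport of `ClusterConnNE` to the sorted twin -/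

namespace Summit.QuantumFields.BalabanUV.T4Continuum.HistoryGen.Pedigree

open Summit.QuantumFields.BalabanUV.T4Continuum.HistoryAdmissible

variable {α π γ β : Type*} [Inhabited γ] [DecidableEq β] (P : Pedigree α π) (cell : π → γ)
  (Zm : ℕ → PGen γ → Finset β)

/-- **THE TRANSPORT TO THE SORTED TWIN, AMENDED LETTERS**: under «oldest line first» and renewal dating and a
member-zone reading the physical births only, `ClusterConnNE` of the realised member is `ClusterConnNE` of the sorted
twin's member. [folklore] -/
theorem clusterConnNE_toPGen_sortR (hH : ∀ c, P.HeadOldest c) (hS : P.RenewDated)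
    (hZ : ∀ t m m', m.pbirths = m'.pbirths → Zm t m = Zm t m') (c : α)
    (H : PGen.ClusterConnNE Zm (P.toPGen cell c)) : PGen.ClusterConnNE Zm (P.sortR.toPGen cell c) :=
  (PGen.clusterConnNE_iff_clusterProp Zm _).2
    (P.clusterProp_toPGen_sortR cell PGen.NonemptyTConn Zm (fun _ _ => PGen.perm_nonemptyTConn) hH hS hZ c
      ((PGen.clusterConnNE_iff_clusterProp Zm _).1 H))

end Summit.QuantumFields.BalabanUV.T4Continuum.HistoryGen.Pedigree

/-! ## §5 Sanity -/

namespace Summit.QuantumFields.BalabanUV.T4Continuum.HistoryMemberClusterConnNE.Sanity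

open Summit.QuantumFields.BalabanUV.T4Continuum.HistoryAdmissible

/-- a renewed birth is `ClusterConnNE` for any member-zone (no join to check) -/
example (Zm : ℕ → PGen ℕ → Finset ℕ) : PGen.ClusterConnNE Zm (PGen.renew (PGen.birth 1 0 7) 4) :=
  (PGen.clusterConnNE_renew_iff Zm _ _).2 (PGen.clusterConnNE_birth Zm _ _ _)

end Summit.QuantumFields.BalabanUV.T4Continuum.HistoryMemberClusterConnNE.Sanity

end
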